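import Summits.QuantumFields.YangMills.Theorems.BalabanUVNodesN16RankNUniformScalarMinimisers
import HarnessLib

/-!
# YM-DAG node N16 (NE3), the re-keyed N07 in-edge — A FLUX LOWER BOUND FOR THE MINIMAL ACTION AT AN ARBITRARY (NON-UNIFORM) SCALAR DATUM, EVERY RANK: every admissible
# `U(n)`-valued competitor of run `k` at an `N`-periodic loose scalar datum `V` has `A^{(k)}(U) ≥ (L^{4−d})^k · (NL^k)^d · Σ_{κ<μ} (1 − cos(Φ_{κμ}(V) ∕ (NL^k)²))`, `Φ_{κμ}(V)` the
# datum's total principal flux through one period square of the `(e_κ,e_μ)`-plane — the uniform datum with the same fluxes is extremal (file F of the g7 piece; comparison principle)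

Cell `pub-ymgap`, width seat `pub-ymgap-dag-n16-w2` (director-ym №197 ∕ HUMAN RULING D-0149), generation 7.  `--kind proof --supports stmt-QuantumFields-27366 --as helper`
(K3⁸, KEY MAP v2).  `bears_on: R4∕N16`, edge N07 → N16.  COUNT-NEUTRAL.

HONEST FRAMING.  Kernel bookkeeping: g6 file 5's flux transport (`chern_iter`, `sum_periodBox_toIocMod_eq` — plane- and datum-generic) on the determinant configuration (file B),
file A's per-plaquette key and g6 6a's Jensen, now at an ARBITRARY loose scalar datum (the abelian sector of the data) instead of the uniform one.  A LOWER BOUND only (no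
minimiser is identified for non-uniform data — that is the located content of node N07, g6 evidence §2); nothing of Bałaban asserted or refuted; DischargeTest `stub_reg910Slot` NOT
closed; no K3⁸ v6 stub named or closed; N16 ∕ N07 NOT discharged; counts UNMOVED (typed 28∕28 · discharged 5∕27 · A 5∕28).  R4 closes the conditional finite-𝕋⁴ rung `BalabanLadder.UV`
only; NOT ℝ⁴ ∕ OS ∕ mass gap; the YM mass gap (Clay) is NOT proved by any of this.

WHAT IS PROVED ([folklore] bookkeeping + cited shapes, 0 `sorry`, 0 `def`; any dimension `d`, any plane `κ ≠ μ`, `n` non-empty; REGIME = leaf-05's rank-scaled as in file C, plus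
`card n·δ ≤ 1∕4` for the datum's plaquette radius `δ` so that `n·θ` stays a principal angle).  §1 `asum_const_mul` (linearity of the path functional), `toIocMod_nat_mul`
(`toIocMod(n·a) = n·toIocMod a` when `|n·toIocMod a| < π`), `theta_det_datum` (the determinant datum's principal plaquette angles are `n` times the datum's).  §2 ★★
`sum_tau_periodBox_plane` (**RANK-`n` FLUX IDENTITY, ANY PLANE, ANY LOOSE SCALAR DATUM**: `(NL^k)²·Σ_{x ∈ [0,NL^k)^d} τ(U(∂p_{κμ}(x))) = (NL^k)^d · n · Φ_{κμ}(V)`).  §3 ★★★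
`levelAction_ge_flux` (**THE FLUX LOWER BOUND** above, every rank) and `minAct_ge_flux` (the same for a minimiser).

DEPENDENCES (by name): file C (`tau_hol_eq_toIocMod`); file B (`exists_det_cfg`, `admissible_det`, `isUnitaryCfg_det`); file A (`one_sub_cos_tau_le_wt`, `abs_tau_div_le`); g6 files 4
(`val_hol_plaqWord_real`, `toIocMod_eq_of_cexp_smul_one_eq`, `abs_toIocMod_le_two_mul`, `cexp_toIocMod_mul_I`), 5 (`chern_iter`, `sum_periodBox_toIocMod_eq`), 6a
(`exists_real_presentation`, `jensen_one_sub_cos`); `MinimalActionLevels` (`levelAction`, `perWin`, `stepWt_pos`, `wt_nonneg_of_unitary`); `MinimalActionSandwich`;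
`MinimalActionRate` (`sfClass`); `T4AveragingDeficitWallBoundary` (`scalarCfg`, `periodBox`, `card_periodBox`); `B7Prop2Explicit.hol_mem_of`.
-/

open scoped BigOperators Matrix Matrix.Norms.L2Operator
open NormedSpace Finset

namespace Summit.QuantumFields.YangMills.BalabanUVNodes.N16ScalarDataFluxLowerBound

open Literature.MathematicalPhysics.QuantumFieldTheory.Balaban1983to89
open B7Prop1Explicit B7Prop2Explicit MatrixLog UnitaryModel
open T4AveragingDeficitWall hiding Site Plane Plaq Bond
open T4AveragingDeficitWallBoundary (scalarCfg IsPeriodicCfg periodBox card_periodBox)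
open FederbushMean (cexp_smul_one)
open Summit.QuantumFields.BalabanUV.T4Continuum
open MinimalActionLevels (levelAction perWin stepWt stepWt_pos wt_nonneg_of_unitary)
open MinimalActionSandwich (IsMinimiser admissible)
open MinimalActionRate (sfClass)
open Summit.QuantumFields.YangMills.BalabanUVNodes.N16ScalarAverageChern (val_hol_plaqWord_real toIocMod_eq_of_cexp_smul_one_eq abs_toIocMod_le_two_mul cexp_toIocMod_mul_I)
open Summit.QuantumFields.YangMills.BalabanUVNodes.N16ScalarFluxTransport (chern_iter sum_periodBox_toIocMod_eq)
open Summit.QuantumFields.YangMills.BalabanUVNodes.N16UniformScalarJensen (exists_real_presentation jensen_one_sub_cos)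
open Summit.QuantumFields.YangMills.BalabanUVNodes.N16RankNWilsonWeightDetPhase (one_sub_cos_tau_le_wt abs_tau_div_le)
open Summit.QuantumFields.YangMills.BalabanUVNodes.N16DetTransport (exists_det_cfg isUnitaryCfg_det admissible_det)
open Summit.QuantumFields.YangMills.BalabanUVNodes.N16RankNUniformScalarMinimisers (tau_hol_eq_toIocMod)

noncomputable section

variable {d : ℕ} {n : Type} [Fintype n] [DecidableEq n] [Nonempty n]

/-! ## §1 The determinant datum's principal plaquette angles are `n` times the datum's -/

omit [Fintype n] [DecidableEq n] [Nonempty n] in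
/-- Linearity of the path functional: `(c·A)(Γ) = c·A(Γ)`. [folklore] -/
theorem asum_const_mul (c : ℝ) (A : B7Prop1Explicit.Site d → Fin d → ℝ) :
    ∀ (x : B7Prop1Explicit.Site d) (w : List (Letter d)), asum (fun y ν => c * A y ν) x w = c * asum A x w
  | x, [] => by simp
  | x, l :: w => by
    rw [asum_cons, asum_cons, asum_const_mul c A (x + l.vec) w]
    rcases l with ⟨μ, _ | _⟩
    · simp only [stepA_false]; ring
    · simp only [stepA_true]; ring

omit [Fintype n] [DecidableEq n] [Nonempty n] in
/-- `toIocMod(m·a) = m·toIocMod(a)` for a natural `m` whenever `|m·toIocMod a| < π` (`m·a` and `m·toIocMod a` differ by an integer multiple of `2π`). [folklore] -/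
theorem toIocMod_nat_mul (m : ℕ) (a : ℝ) (h : |(m : ℝ) * toIocMod Real.two_pi_pos (-Real.pi) a| < Real.pi) :
    toIocMod Real.two_pi_pos (-Real.pi) ((m : ℝ) * a) = (m : ℝ) * toIocMod Real.two_pi_pos (-Real.pi) a := by
  set t := toIocMod Real.two_pi_pos (-Real.pi) a with ht
  obtain ⟨q, hq⟩ : ∃ q : ℤ, a = t + q • (2 * Real.pi) :=
    ⟨toIocDiv Real.two_pi_pos (-Real.pi) a, by rw [ht]; exact (toIocMod_add_toIocDiv_zsmul _ _ _).symm⟩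
  have hma : (m : ℝ) * a = (m : ℝ) * t + ((m : ℤ) * q) • (2 * Real.pi) := by
    rw [hq, mul_add, zsmul_eq_mul, zsmul_eq_mul]; push_cast; ring
  rw [hma, toIocMod_add_zsmul, toIocMod_eq_self, Set.mem_Ioc]
  rw [abs_lt] at h
  constructor <;> linarith [h.1, h.2]

/-- **The determinant datum's principal plaquette angles**: for the scalar datum `V = e^{iG}·1_n` with `SmallField V δ` and `card n·δ ≤ 1∕4`, the rank-`m` scalar configuration
`e^{i·n·G}·1` has principal `(e_κ,e_μ)`-angles `n·θ_G` (`|θ_G| ≤ 2δ`, so `|n·θ_G| ≤ 1∕2 < π`). [folklore] -/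
theorem theta_det_datum {G : B7Prop1Explicit.Site d → Fin d → ℝ} {δ : ℝ}
    (hV : SmallField (scalarCfg (n := n) (fun y ν => ((G y ν : ℝ) : ℂ) * Complex.I)) δ) (hδn : Fintype.card n * δ ≤ 1 / 4)
    (x : B7Prop1Explicit.Site d) {κ μ : Fin d} (hκμ : κ ≠ μ) :
    toIocMod Real.two_pi_pos (-Real.pi) (asum (fun y ν => Fintype.card n * G y ν) x (plaqWord κ μ))
      = Fintype.card n * toIocMod Real.two_pi_pos (-Real.pi) (asum G x (plaqWord κ μ)) := by
  rw [asum_const_mul]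
  apply toIocMod_nat_mul
  have hθ := abs_toIocMod_le_two_mul (n := n) hV x hκμ
  have hc0 : (0 : ℝ) ≤ Fintype.card n := by positivity
  rw [abs_mul, abs_of_nonneg hc0]
  have hπ : (3 : ℝ) < Real.pi := Real.pi_gt_three
  nlinarith [mul_le_mul_of_nonneg_left hθ hc0]

/-! ## §2 The rank-`n` flux identity for an arbitrary plane and an arbitrary loose scalar datum -/

/-- **★★ THE RANK-`n` FLUX IDENTITY, ANY PLANE `κ ≠ μ`, ANY LOOSE SCALAR DATUM**: for an `N`-periodic scalar datum `V = e^{iG}·1_n` with `SmallField V δ`, `card n·δ ≤ 1∕4`, and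
every admissible `U(n)`-valued competitor `U` of run `k` over `sfClass d L N ec` (rank-scaled leaf-05 regime, `L ≥ 2`):
`(NL^k)²·Σ_{x ∈ [0,NL^k)^d} τ(U(∂p_{κμ}(x))) = (NL^k)^d · n · Φ_{κμ}(V)`, `Φ_{κμ}(V) := Σ_{i,j<N} θ_G(i e_κ + j e_μ)` the datum's total principal flux through one period square — g6
file 5's `chern_iter` + `sum_periodBox_toIocMod_eq` on the rank-one determinant configuration (file B). [cite: Balaban1985Averaging, (43) p.24, Prop. 2 p.26] -/
theorem sum_tau_periodBox_plane {L : ℕ} (hL : 2 ≤ L) {N : ℕ} (hN : 1 ≤ N) {ec : ℝ} (he0 : 0 ≤ ec) (he1n : 16 * C0 d * (2 * Fintype.card n * ec) ≤ 3)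
    (he2n : 1024 * ((d : ℝ) + 1) * (d + 4) * (L : ℝ) ^ 2 * (2 * Fintype.card n * ec) ≤ 1) {k : ℕ}
    {G : B7Prop1Explicit.Site d → Fin d → ℝ} {δ : ℝ} (hV : SmallField (scalarCfg (n := n) (fun y ν => ((G y ν : ℝ) : ℂ) * Complex.I)) δ) (hδn : Fintype.card n * δ ≤ 1 / 4)
    {U : B7Prop1Explicit.Site d → Fin d → (Matrix n n ℂ)ˣ}
    (hU : U ∈ admissible (sfClass d L N ec) L k (scalarCfg (n := n) (fun y ν => ((G y ν : ℝ) : ℂ) * Complex.I))) {κ μ : Fin d} (hκμ : κ ≠ μ) :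
    ((N * L ^ k : ℕ) : ℝ) ^ 2 * ∑ x ∈ periodBox (N * L ^ k), (mlog ((hol U x (plaqWord κ μ) : (Matrix n n ℂ)ˣ) : Matrix n n ℂ)).trace.im
      = ((N * L ^ k : ℕ) : ℝ) ^ d * (Fintype.card n *
          ∑ i ∈ Finset.range N, ∑ j ∈ Finset.range N, toIocMod Real.two_pi_pos (-Real.pi) (asum G ((i : ℤ) • e κ + (j : ℤ) • e μ) (plaqWord κ μ))) := by
  have hc1 : (1 : ℝ) ≤ Fintype.card n := by exact_mod_cast Fintype.card_pos
  have hC : 0 < C0 d := C0_pos d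
  -- the regime for `U` itself and the determinant regimes
  have hmono : ec ≤ 2 * Fintype.card n * ec := by nlinarith
  have he1 : 16 * C0 d * ec ≤ 3 := (mul_le_mul_of_nonneg_left hmono (by positivity)).trans he1n
  have he0' : 0 ≤ 2 * Fintype.card n * ec := by positivity
  have hd0 : (0 : ℝ) ≤ d := by positivity
  have hL2r : (2 : ℝ) ≤ L := by exact_mod_cast hL
  have h4 : (4 : ℝ) ≤ ((d : ℝ) + 1) * (d + 4) := by nlinarith
  have hL4 : (4 : ℝ) ≤ (L : ℝ) ^ 2 := by nlinarith
  have h16 : (16 : ℝ) ≤ ((d : ℝ) + 1) * (d + 4) * (L : ℝ) ^ 2 := by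
    have := mul_le_mul h4 hL4 (by norm_num) (by positivity); linarith
  have key : 1024 * (((d : ℝ) + 1) * (d + 4) * (L : ℝ) ^ 2) * (2 * Fintype.card n * ec) ≤ 1 := by
    calc 1024 * (((d : ℝ) + 1) * (d + 4) * (L : ℝ) ^ 2) * (2 * Fintype.card n * ec)
        = 1024 * ((d : ℝ) + 1) * (d + 4) * (L : ℝ) ^ 2 * (2 * Fintype.card n * ec) := by ring
      _ ≤ 1 := he2n
  have h72 : 16 * (2 * Fintype.card n * ec) ≤ ((d : ℝ) + 1) * (d + 4) * (L : ℝ) ^ 2 * (2 * Fintype.card n * ec) := mul_le_mul_of_nonneg_right h16 he0'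
  have hnec : Fintype.card n * ec ≤ 1 / 3 := by nlinarith
  have he2B : 1024 * Fintype.card n * ((d : ℝ) + 1) * (d + 4) * (L : ℝ) ^ 2 * ec ≤ 1 := by
    calc 1024 * Fintype.card n * ((d : ℝ) + 1) * (d + 4) * (L : ℝ) ^ 2 * ec
        = (1024 * ((d : ℝ) + 1) * (d + 4) * (L : ℝ) ^ 2 * (2 * Fintype.card n * ec)) / 2 := by ring
      _ ≤ 1 := by linarith
  have he2' : 1024 * (d + 1) * (d + 4) * (L : ℝ) ^ 2 * (2 * Fintype.card n * ec) ≤ 1 := by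
    calc 1024 * (d + 1) * (d + 4) * (L : ℝ) ^ 2 * (2 * Fintype.card n * ec) = 1024 * ((d : ℝ) + 1) * (d + 4) * (L : ℝ) ^ 2 * (2 * Fintype.card n * ec) := by ring
      _ ≤ 1 := he2n
  -- the determinant configuration (rank one) and its real presentation
  obtain ⟨u, hdet⟩ := exists_det_cfg (m := Fin 1) U
  have hadm' := admissible_det (m := Fin 1) hL he0 he1 he2B hdet hU
  obtain ⟨A, hA⟩ := exists_real_presentation (n := Fin 1) (isUnitaryCfg_det hdet hU.1.1)
  rw [hA] at hadm' hdet
  obtain ⟨⟨_, hPer, hSm⟩, havg⟩ := hadm'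
  set M : ℕ := N * L ^ k with hMdef
  have hM : 1 ≤ M := Nat.one_le_iff_ne_zero.mpr (Nat.mul_ne_zero (by omega) (pow_ne_zero _ (by omega)))
  -- (1) `chern_iter` at rank one, `j = k`: the determinant datum's period-square flux equals the competitor's
  obtain ⟨Ak, hAk, hflux⟩ := chern_iter (n := Fin 1) (d := d) hL (N := N) he0' he1n he2' hPer hSm hκμ k le_rfl
  rw [havg] at hAk
  rw [Nat.sub_self, pow_zero, mul_one] at hflux
  -- (2) the two presentations of the determinant datum have the same principal angles, `= n·θ_G`
  have hθdat : ∀ y : B7Prop1Explicit.Site d, toIocMod Real.two_pi_pos (-Real.pi) (asum Ak y (plaqWord κ μ))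
      = Fintype.card n * toIocMod Real.two_pi_pos (-Real.pi) (asum G y (plaqWord κ μ)) := by
    intro y
    have h1 := val_hol_plaqWord_real (n := Fin 1) Ak y κ μ
    have h2 := val_hol_plaqWord_real (n := Fin 1) (fun y ν => Fintype.card n * G y ν) y κ μ
    rw [← hAk] at h1
    have h3 : ((hol (scalarCfg (n := Fin 1) (fun y ν => (((Fintype.card n * G y ν : ℝ)) : ℂ) * Complex.I)) y (plaqWord κ μ) : (Matrix (Fin 1) (Fin 1) ℂ)ˣ) :
        Matrix (Fin 1) (Fin 1) ℂ) = ((hol (scalarCfg (n := Fin 1) (fun y ν => ((((fun y ν => Fintype.card n * G y ν) y ν : ℝ)) : ℂ) * Complex.I)) y (plaqWord κ μ) :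
        (Matrix (Fin 1) (Fin 1) ℂ)ˣ) : Matrix (Fin 1) (Fin 1) ℂ) := rfl
    rw [h3, h2] at h1
    have h4 := toIocMod_eq_of_cexp_smul_one_eq (n := Fin 1) h1
    rw [toIocMod_toIocMod, toIocMod_toIocMod] at h4
    rw [← h4, theta_det_datum (n := n) hV hδn y hκμ]
  simp_rw [hθdat] at hflux
  simp_rw [← Finset.mul_sum] at hflux
  -- (3) box total vs slice at rank one; competitor radius `2n·ec/(L^k)² ≤ 1/2`
  have hL1r : (1 : ℝ) ≤ ((L : ℝ) ^ k) ^ 2 := one_le_pow₀ (one_le_pow₀ (by exact_mod_cast (show 1 ≤ L by omega)))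
  have ha2 : 2 * (2 * Fintype.card n * ec / ((L : ℝ) ^ k) ^ 2) ≤ 1 := by
    have := div_le_self he0' hL1r; nlinarith
  have hbox := sum_periodBox_toIocMod_eq (n := Fin 1) hM ha2 hSm hPer hκμ
  rw [← hflux] at hbox
  -- (4) the competitor's principal angles are the determinant phases
  rw [← hbox]
  congr 1
  refine Finset.sum_congr rfl fun x _ => ?_
  refine tau_hol_eq_toIocMod (m := Fin 1) hU.1.1 hdet x ?_
  have hs := (hU.1.2.2 x κ μ hκμ).trans (div_le_self he0 hL1r)
  have hc0 : (0 : ℝ) ≤ Fintype.card n := by positivity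
  exact (mul_le_mul_of_nonneg_left hs hc0).trans hnec

/-! ## §3 The flux lower bound for the level action at an arbitrary loose scalar datum, every rank -/

/-- **★★★ THE FLUX LOWER BOUND (comparison principle), EVERY RANK**: at an `N`-periodic loose scalar datum `V = e^{iG}·1_n` (`SmallField V δ`, `card n·δ ≤ 1∕4`; rank-scaled
leaf-05 regime; `L ≥ 2`, `N ≥ 1`), EVERY admissible `U(n)`-valued competitor `U` of run `k` over `sfClass d L N ec` obeys
`A^{(k)}(U) ≥ (L^{4−d})^{k} · (NL^k)^d · Σ_{κ<μ} (1 − cos(Φ_{κμ}(V) ∕ (NL^k)²))` — plane by plane: `1 − Re tr∕n ≥ 1 − cos(τ∕n)` (file A), Jensen over the period box (g6 6a), and §2's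
flux identity fixing the mean angle `Φ_{κμ}(V)∕(NL^k)²`.  For the uniform datum (`Φ₀₁ = N²ω`, all other `Φ = 0`) this is file C's bound, attained there.
[cite: Balaban1985Variational, (5)–(8) pp.278–279] -/
theorem levelAction_ge_flux {L : ℕ} (hL : 2 ≤ L) {N : ℕ} (hN : 1 ≤ N) {ec : ℝ} (he0 : 0 ≤ ec) (he1n : 16 * C0 d * (2 * Fintype.card n * ec) ≤ 3)
    (he2n : 1024 * ((d : ℝ) + 1) * (d + 4) * (L : ℝ) ^ 2 * (2 * Fintype.card n * ec) ≤ 1) {k : ℕ}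
    {G : B7Prop1Explicit.Site d → Fin d → ℝ} {δ : ℝ} (hV : SmallField (scalarCfg (n := n) (fun y ν => ((G y ν : ℝ) : ℂ) * Complex.I)) δ) (hδn : Fintype.card n * δ ≤ 1 / 4)
    {U : B7Prop1Explicit.Site d → Fin d → (Matrix n n ℂ)ˣ}
    (hU : U ∈ admissible (sfClass d L N ec) L k (scalarCfg (n := n) (fun y ν => ((G y ν : ℝ) : ℂ) * Complex.I))) :
    ((stepWt d L)⁻¹) ^ k * (((N * L ^ k : ℕ) : ℝ) ^ d * ∑ π : T4AveragingDeficitWall.Plane d,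
        (1 - Real.cos ((∑ i ∈ Finset.range N, ∑ j ∈ Finset.range N,
          toIocMod Real.two_pi_pos (-Real.pi) (asum G ((i : ℤ) • e π.1.1 + (j : ℤ) • e π.1.2) (plaqWord π.1.1 π.1.2))) / ((N * L ^ k : ℕ) : ℝ) ^ 2)))
      ≤ levelAction d L N k U := by
  have hL1 : 1 ≤ L := by omega
  have hc1 : (1 : ℝ) ≤ Fintype.card n := by exact_mod_cast Fintype.card_pos
  have hc : (0 : ℝ) < Fintype.card n := by positivity
  set M : ℕ := N * L ^ k with hMdef
  have hM : 1 ≤ M := Nat.one_le_iff_ne_zero.mpr (Nat.mul_ne_zero (by omega) (pow_ne_zero _ (by omega)))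
  have hMr : (0 : ℝ) < (M : ℝ) := by exact_mod_cast (show 0 < M by omega)
  have hne : (periodBox (d := d) M).Nonempty := by rw [← Finset.card_pos, card_periodBox]; positivity
  -- the guard at every plaquette of `U`: `n·ec ≤ 1/3`
  have hd0 : (0 : ℝ) ≤ d := by positivity
  have hL2r : (2 : ℝ) ≤ L := by exact_mod_cast hL
  have h4 : (4 : ℝ) ≤ ((d : ℝ) + 1) * (d + 4) := by nlinarith
  have hL4 : (4 : ℝ) ≤ (L : ℝ) ^ 2 := by nlinarith
  have h16 : (16 : ℝ) ≤ ((d : ℝ) + 1) * (d + 4) * (L : ℝ) ^ 2 := by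
    have := mul_le_mul h4 hL4 (by norm_num) (by positivity); linarith
  have he0' : 0 ≤ 2 * Fintype.card n * ec := by positivity
  have key : 1024 * (((d : ℝ) + 1) * (d + 4) * (L : ℝ) ^ 2) * (2 * Fintype.card n * ec) ≤ 1 := by
    calc 1024 * (((d : ℝ) + 1) * (d + 4) * (L : ℝ) ^ 2) * (2 * Fintype.card n * ec)
        = 1024 * ((d : ℝ) + 1) * (d + 4) * (L : ℝ) ^ 2 * (2 * Fintype.card n * ec) := by ring
      _ ≤ 1 := he2n
  have h72 : 16 * (2 * Fintype.card n * ec) ≤ ((d : ℝ) + 1) * (d + 4) * (L : ℝ) ^ 2 * (2 * Fintype.card n * ec) := mul_le_mul_of_nonneg_right h16 he0'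
  have hec3 : ec ≤ 1 / 3 := by nlinarith
  have hL1r : (1 : ℝ) ≤ ((L : ℝ) ^ k) ^ 2 := one_le_pow₀ (one_le_pow₀ (by exact_mod_cast hL1))
  have hsmall : ∀ (x : B7Prop1Explicit.Site d) (κ μ : Fin d), κ ≠ μ → ‖((hol U x (plaqWord κ μ) : (Matrix n n ℂ)ˣ) : Matrix n n ℂ) - 1‖ ≤ 1 / 3 :=
    fun x κ μ hκμ => ((hU.1.2.2 x κ μ hκμ).trans (div_le_self he0 hL1r)).trans hec3
  -- plane by plane
  have hplane : ∀ π : T4AveragingDeficitWall.Plane d,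
      ((M : ℕ) : ℝ) ^ d * (1 - Real.cos ((∑ i ∈ Finset.range N, ∑ j ∈ Finset.range N,
          toIocMod Real.two_pi_pos (-Real.pi) (asum G ((i : ℤ) • e π.1.1 + (j : ℤ) • e π.1.2) (plaqWord π.1.1 π.1.2))) / ((M : ℕ) : ℝ) ^ 2))
        ≤ ∑ x ∈ periodBox M, wt (hol U x (plaqWord π.1.1 π.1.2)) := by
    intro π
    have hκμ : π.1.1 ≠ π.1.2 := ne_of_lt π.2
    have hbox := sum_tau_periodBox_plane hL hN he0 he1n he2n hV hδn hU hκμ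
    rw [← hMdef] at hbox
    -- mean of `τ_x/n` over the box = `Φ/M²`
    have hmean : (∑ x ∈ periodBox M, (mlog ((hol U x (plaqWord π.1.1 π.1.2) : (Matrix n n ℂ)ˣ) : Matrix n n ℂ)).trace.im / Fintype.card n) / (periodBox (d := d) M).card
        = (∑ i ∈ Finset.range N, ∑ j ∈ Finset.range N,
            toIocMod Real.two_pi_pos (-Real.pi) (asum G ((i : ℤ) • e π.1.1 + (j : ℤ) • e π.1.2) (plaqWord π.1.1 π.1.2))) / ((M : ℕ) : ℝ) ^ 2 := by
      have hMne : ((M : ℕ) : ℝ) ≠ 0 := hMr.ne'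
      have hsum : ∑ x ∈ periodBox M, (mlog ((hol U x (plaqWord π.1.1 π.1.2) : (Matrix n n ℂ)ˣ) : Matrix n n ℂ)).trace.im
          = ((M : ℕ) : ℝ) ^ d * (Fintype.card n * ∑ i ∈ Finset.range N, ∑ j ∈ Finset.range N,
              toIocMod Real.two_pi_pos (-Real.pi) (asum G ((i : ℤ) • e π.1.1 + (j : ℤ) • e π.1.2) (plaqWord π.1.1 π.1.2))) / ((M : ℕ) : ℝ) ^ 2 := by
        rw [eq_div_iff (pow_ne_zero 2 hMne), mul_comm, hbox]
      rw [← Finset.sum_div, card_periodBox, hsum, Nat.cast_pow]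
      field_simp
    have hθ : ∀ x ∈ periodBox (d := d) M, |(mlog ((hol U x (plaqWord π.1.1 π.1.2) : (Matrix n n ℂ)ˣ) : Matrix n n ℂ)).trace.im / Fintype.card n| ≤ Real.pi / 2 :=
      fun x _ => (abs_tau_div_le ((hsmall x _ _ hκμ).trans (by norm_num))).trans (by linarith [hsmall x _ _ hκμ, Real.pi_gt_three])
    have hJ := jensen_one_sub_cos _ hne _ hθ
    rw [hmean, card_periodBox] at hJ
    push_cast at hJ ⊢
    exact hJ.trans (Finset.sum_le_sum fun x _ => one_sub_cos_tau_le_wt (hol_mem_of hU.1.1 x _) (hsmall x _ _ hκμ))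
  -- sum over planes and reorder the period-window sum
  unfold levelAction fineAction
  have hsw : 0 < ((stepWt d L)⁻¹) ^ k := pow_pos (inv_pos.mpr (stepWt_pos L hL1)) k
  refine mul_le_mul_of_nonneg_left ?_ hsw.le
  rw [Finset.mul_sum, perWin, Finset.sum_product, Finset.sum_comm]
  refine Finset.sum_le_sum fun π _ => ?_
  simpa only [fhol, hMdef] using hplane π

/-- **★★★ … hence for a MINIMISER**: the minimal level-`k` action at an arbitrary loose scalar datum is at least the flux bound. [cite: Balaban1985Variational, (5)–(8) pp.278–279] -/
theorem minAct_ge_flux {L : ℕ} (hL : 2 ≤ L) {N : ℕ} (hN : 1 ≤ N) {ec : ℝ} (he0 : 0 ≤ ec) (he1n : 16 * C0 d * (2 * Fintype.card n * ec) ≤ 3)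
    (he2n : 1024 * ((d : ℝ) + 1) * (d + 4) * (L : ℝ) ^ 2 * (2 * Fintype.card n * ec) ≤ 1) {k : ℕ}
    {G : B7Prop1Explicit.Site d → Fin d → ℝ} {δ : ℝ} (hV : SmallField (scalarCfg (n := n) (fun y ν => ((G y ν : ℝ) : ℂ) * Complex.I)) δ) (hδn : Fintype.card n * δ ≤ 1 / 4)
    {U : B7Prop1Explicit.Site d → Fin d → (Matrix n n ℂ)ˣ}
    (hmin : IsMinimiser d (sfClass d L N ec) L N k (scalarCfg (n := n) (fun y ν => ((G y ν : ℝ) : ℂ) * Complex.I)) U) :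
    ((stepWt d L)⁻¹) ^ k * (((N * L ^ k : ℕ) : ℝ) ^ d * ∑ π : T4AveragingDeficitWall.Plane d,
        (1 - Real.cos ((∑ i ∈ Finset.range N, ∑ j ∈ Finset.range N,
          toIocMod Real.two_pi_pos (-Real.pi) (asum G ((i : ℤ) • e π.1.1 + (j : ℤ) • e π.1.2) (plaqWord π.1.1 π.1.2))) / ((N * L ^ k : ℕ) : ℝ) ^ 2)))
      ≤ MinimalActionSandwich.minAct d (sfClass d L N ec) L N k (scalarCfg (n := n) (fun y ν => ((G y ν : ℝ) : ℂ) * Complex.I)) := by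
  rw [hmin.minAct_eq]
  exact levelAction_ge_flux hL hN he0 he1n he2n hV hδn hmin.mem

end

end Summit.QuantumFields.YangMills.BalabanUVNodes.N16ScalarDataFluxLowerBound
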